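import Summits.HubbardSuperconductivity.HubbardSuperconductivity.Theorems.AnisotropyChordSpinMonotoneTwoMagnonInvariant

/-!
# Route `AnisotropyChord`: the FERROMAGNETIC CEILING on every connected graph — the `Δ = 1` sector
# ground state maximises the condensate over the whole sector (the end point `Δ₂ = 1` of `U_vt`/`M_Δ`
# holds graph-generally, in every sector, against every sector state)

`H(Δ) = xxzHamiltonian 1 G (−1) Δ` (spin ½) on a finite CONNECTED simple graph, any magnetisation
sector of weight `W` (`S^z_tot = |V|/2 − W`), `Λ(ψ) = Re⟨ψ, S⁺_tot S⁻_tot ψ⟩`: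

* `xxzOne_mulVec_flatW` — the flat vector `φ_W = 1_{weight W}` is an eigenvector of the isotropic
  ferromagnet, `H(1) φ_W = −(|E|/4) φ_W` (every transposition fixes `φ_W`, so `𝐒_x·𝐒_y φ_W = ¼ φ_W`);
* `lowestEnergy_at_one_weight` — the sector energy at `Δ = 1` is `−|E|/4` (`H(1) + |E|/4 ⪰ 0`,
  `TwoMagnon.posSemidef_xxzOne_add`), and `sectorGS_at_one_eq_smul_flatW` — by Perron–Frobenius every
  sector ground vector at `Δ = 1` is a multiple of `φ_W`;
* `re_totalSpinSq_flatW` — `Re⟨φ_W, 𝐒² φ_W⟩ = (|V|/2)(|V|/2 + 1)‖φ_W‖²` (the Casimir split of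
  `…SpinMonotoneExchangeBound` along the complete graph: `φ_W` is symmetric under every transposition);
  `re_totalSpinSq_le_casimirMax` — `Re⟨ψ, 𝐒² ψ⟩ ≤ (|V|/2)(|V|/2 + 1)‖ψ‖²` for every `ψ`
  (`posSemidef_casimirBound_sub`);
* `condensate_le_ferroCeiling` — **for every normalised sector vector `ψ₁` (ground state or not, any
  `Δ₁`) and every normalised sector ground state `ψ₂` of `H(1)`: `Λ(ψ₁) ≤ Λ(ψ₂)`**;
  `condensateMonotone_at_one` — the `Δ₂ = 1` end point of `VertexTransitiveCondensateMonotone`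
  (`…SpinMonotoneDefs`) on every connected graph, vertex-transitive or not.

H. Tasaki, *Physics and Mathematics of Quantum Many-Body Systems* (2020) §2.4–2.5, App. A.3;
E. Lieb, D. Mattis, J. Math. Phys. 3 (1962) 749.  No definition is introduced.
-/

set_option linter.dupNamespace false

noncomputable section

namespace Summit.HubbardSuperconductivity.HubbardSuperconductivity.Theorems.AnisotropyChord

open Matrix Complex Finset
open scoped ComplexOrder
open Literature.MathematicalPhysics.QuantumLattice
open Summit.HubbardSuperconductivity.HubbardSuperconductivity.Theorems.PolyaSchurPairBoson

variable {V : Type*} [Fintype V] [DecidableEq V]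

/-! ### The flat vector of weight `W` -/

/-- The flat vector of weight `W` lies in the sector `S^z_tot = |V|/2 − W`. [folklore] -/
theorem flatW_mem_spinZSector {W : ℕ} {φ : (V → Fin 2) → ℂ}
    (hφ : ∀ σ, φ σ = if (∑ z, (σ z : ℕ)) = W then 1 else 0) :
    φ ∈ spinZSector (Λ := V) 1 (((Fintype.card V * 1 : ℕ) : ℝ) / 2 - W) :=
  (LiebMattis.mem_spinZSector_weight_iff (Λ := V) 1 W φ).2 fun σ hσ => by rw [hφ σ, if_neg hσ]

/-- **The flat vector of weight `W` is an eigenvector of the isotropic ferromagnet**: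
`H(1) φ_W = −(|E|/4) φ_W`. Tasaki (2020) §2.4–2.5. [folklore] -/
theorem xxzOne_mulVec_flatW (G : SimpleGraph V) [DecidableRel G.Adj] {W : ℕ} {φ : (V → Fin 2) → ℂ}
    (hφ : ∀ σ, φ σ = if (∑ z, (σ z : ℕ)) = W then 1 else 0) :
    (xxzHamiltonian 1 G (-1) 1 : Op V 2) *ᵥ φ = (-((G.edgeFinset.card : ℂ) / 4)) • φ := by
  have hswap : ∀ x y : V, ∀ σ : V → Fin 2, φ (σ ∘ Equiv.swap x y) = φ σ := by
    intro x y σ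
    rw [hφ, hφ σ,
      Summit.HubbardSuperconductivity.HubbardSuperconductivity.Theorems.LevyLogBootstrap.weight_comp_equiv
        (Equiv.swap x y) σ]
  rw [xxz_at_one_eq_neg_heisenberg, heisenbergHamiltonian, Complex.ofReal_one, one_smul,
    Matrix.neg_mulVec, Matrix.sum_mulVec]
  have hterm : ∀ e ∈ G.edgeFinset, (spinDotSym 1 e : Op V 2) *ᵥ φ = (1 / 4 : ℂ) • φ := by
    intro e he
    induction e using Sym2.ind with
    | h x y =>
      rw [SimpleGraph.mem_edgeFinset, SimpleGraph.mem_edgeSet] at he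
      rw [spinDotSym_mk]
      exact spinDot_one_mulVec_of_comp_swap he.ne (hswap x y)
  rw [Finset.sum_congr rfl hterm, Finset.sum_const, ← Nat.cast_smul_eq_nsmul ℂ, smul_smul,
    ← neg_smul]
  congr 1
  ring

/-- **The sector energy at `Δ = 1` is `−|E|/4`** in every nonempty sector (the flat vector attains it;
`H(1) + |E|/4 ⪰ 0`). Tasaki (2020) §2.5. [folklore] -/
theorem lowestEnergy_at_one_weight (G : SimpleGraph V) [DecidableRel G.Adj] {W : ℕ}
    {φ : (V → Fin 2) → ℂ} (hφ : ∀ σ, φ σ = if (∑ z, (σ z : ℕ)) = W then 1 else 0) (hφ0 : φ ≠ 0) :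
    lowestEnergyInSector 1 (xxzHamiltonian 1 G (-1) 1) (((Fintype.card V * 1 : ℕ) : ℝ) / 2 - W) =
      -((G.edgeFinset.card : ℝ) / 4) := by
  set K := spinZSector (Λ := V) 1 (((Fintype.card V * 1 : ℕ) : ℝ) / 2 - W) with hK
  have hφK : φ ∈ K := flatW_mem_spinZSector hφ
  refine le_antisymm ?_ ?_
  · have h := minEnergyOn_mul_le_re_rayleigh (xxzHamiltonian_isHermitian 1 G (-1) 1) K hφK
    have hsc : (-((G.edgeFinset.card : ℂ) / 4)) = ((-((G.edgeFinset.card : ℝ) / 4) : ℝ) : ℂ) := by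
      push_cast; ring
    rw [xxzOne_mulVec_flatW G hφ, hsc, dotProduct_smul, smul_eq_mul, Complex.re_ofReal_mul] at h
    have hpos : 0 < (star φ ⬝ᵥ φ).re := by
      have h1 := Matrix.dotProduct_star_self_pos_iff.2 hφ0
      have h2 := (Complex.lt_def.1 h1).1
      rwa [Complex.zero_re] at h2
    exact le_of_mul_le_mul_right h hpos
  · have hKinv : ∀ v ∈ K, xxzHamiltonian 1 G (-1) 1 *ᵥ v ∈ K := by
      intro v hv
      rw [xxz_at_one_eq_neg_heisenberg, neg_mulVec]
      exact K.neg_mem (heisenberg_mulVec_mem_spinZSector 1 G 1 hv)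
    have hKne : K ≠ ⊥ := fun h => hφ0 ((Submodule.mem_bot ℂ).1 (h ▸ hφK))
    obtain ⟨χ, hχK, hχ1, hχH⟩ :=
      exists_unit_eigen_minEnergyOn (xxzHamiltonian_isHermitian 1 G (-1) 1) K hKinv hKne
    have hE : (star χ ⬝ᵥ (xxzHamiltonian 1 G (-1) 1 *ᵥ χ)).re =
        lowestEnergyInSector 1 (xxzHamiltonian 1 G (-1) 1) (((Fintype.card V * 1 : ℕ) : ℝ) / 2 - W) := by
      rw [hχH, dotProduct_smul, hχ1, smul_eq_mul, mul_one, Complex.ofReal_re]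
      rfl
    have hL := (Complex.le_def.1 ((TwoMagnon.posSemidef_xxzOne_add G).dotProduct_mulVec_nonneg χ)).1
    rw [add_mulVec, smul_mulVec, one_mulVec, dotProduct_add, dotProduct_smul, hχ1, Complex.add_re,
      Complex.zero_re, smul_eq_mul, mul_one, Complex.ofReal_re, hE] at hL
    linarith

/-- **At `Δ = 1` every sector ground vector is a multiple of the flat vector of the sector**
(connected graph; Perron–Frobenius uniqueness). Tasaki (2020) §2.4–2.5. [folklore] -/
theorem sectorGS_at_one_eq_smul_flatW (G : SimpleGraph V) [DecidableRel G.Adj] (hG : G.Connected)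
    {W : ℕ} {φ : (V → Fin 2) → ℂ} (hφ : ∀ σ, φ σ = if (∑ z, (σ z : ℕ)) = W then 1 else 0) (hφ0 : φ ≠ 0)
    {ψ : (V → Fin 2) → ℂ} (hψ : ψ ∈ spinZSector (Λ := V) 1 (((Fintype.card V * 1 : ℕ) : ℝ) / 2 - W))
    (hHψ : xxzHamiltonian 1 G (-1) 1 *ᵥ ψ =
      ((lowestEnergyInSector 1 (xxzHamiltonian 1 G (-1) 1)
        (((Fintype.card V * 1 : ℕ) : ℝ) / 2 - W) : ℝ) : ℂ) • ψ) :
    ∃ c : ℂ, ψ = c • φ := by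
  have hHφ : xxzHamiltonian 1 G (-1) 1 *ᵥ φ =
      ((lowestEnergyInSector 1 (xxzHamiltonian 1 G (-1) 1)
        (((Fintype.card V * 1 : ℕ) : ℝ) / 2 - W) : ℝ) : ℂ) • φ := by
    rw [lowestEnergy_at_one_weight G hφ hφ0, xxzOne_mulVec_flatW G hφ]
    push_cast
    rfl
  exact TwoMagnon.sectorGS_smul_of_sectorGS G hG 1 _ (flatW_mem_spinZSector hφ) hφ0 hHφ hψ hHψ

/-! ### The Casimir at the flat vector and the Casimir ceiling -/

/-- **The flat vector has maximal total spin**: `Re⟨φ_W, 𝐒² φ_W⟩ = (|V|/2)(|V|/2 + 1)·‖φ_W‖²`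
(the Casimir split `…ExchangeBound.re_totalSpinSq_eq_graph` along the complete graph: `φ_W` is
symmetric under every transposition, so every pair contributes `¼`). Tasaki (2020) App. A.3.
[folklore] -/
theorem re_totalSpinSq_flatW {W : ℕ} {φ : (V → Fin 2) → ℂ}
    (hφ : ∀ σ, φ σ = if (∑ z, (σ z : ℕ)) = W then 1 else 0) :
    (star φ ⬝ᵥ ((totalSpinSq 1 : Op V 2) *ᵥ φ)).re =
      (Fintype.card V : ℝ) / 2 * ((Fintype.card V : ℝ) / 2 + 1) * (star φ ⬝ᵥ φ).re := by
  have hswap : ∀ x y : V, ∀ σ : V → Fin 2, φ (σ ∘ Equiv.swap x y) = φ σ := by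
    intro x y σ
    rw [hφ, hφ σ,
      Summit.HubbardSuperconductivity.HubbardSuperconductivity.Theorems.LevyLogBootstrap.weight_comp_equiv
        (Equiv.swap x y) σ]
  have h1 := re_totalSpinSq_eq_graph (⊤ : SimpleGraph V) φ
  have hsc : (-(((⊤ : SimpleGraph V).edgeFinset.card : ℂ) / 4)) =
      ((-(((⊤ : SimpleGraph V).edgeFinset.card : ℝ) / 4) : ℝ) : ℂ) := by
    push_cast; ring
  have h2 : (star φ ⬝ᵥ ((xxzHamiltonian 1 (⊤ : SimpleGraph V) (-1) 1 : Op V 2) *ᵥ φ)).re =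
      -(((⊤ : SimpleGraph V).edgeFinset.card : ℝ) / 4) * (star φ ⬝ᵥ φ).re := by
    rw [xxzOne_mulVec_flatW ⊤ hφ, hsc, dotProduct_smul, smul_eq_mul, Complex.re_ofReal_mul]
  have h3 : ∑ e ∈ (⊤ : SimpleGraph V)ᶜ.edgeFinset, (star φ ⬝ᵥ ((spinDotSym 1 e : Op V 2) *ᵥ φ)).re =
      ∑ _e ∈ (⊤ : SimpleGraph V)ᶜ.edgeFinset, (1 / 4 : ℝ) * (star φ ⬝ᵥ φ).re := by
    refine Finset.sum_congr rfl fun e he => ?_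
    revert he
    induction e using Sym2.ind with
    | h x y =>
      intro he
      rw [SimpleGraph.mem_edgeFinset, SimpleGraph.mem_edgeSet] at he
      rw [spinDotSym_mk]
      exact re_expect_spinDot_one_of_comp_swap he.ne (hswap x y)
  have hcount : (((⊤ : SimpleGraph V).edgeFinset.card : ℝ)) + ((⊤ : SimpleGraph V)ᶜ.edgeFinset.card : ℝ) =
      ((Fintype.card V).choose 2 : ℝ) := by
    have h := sum_edgeFinset_top_eq_add_compl (⊤ : SimpleGraph V) (fun _ => (1 : ℝ))
    simp only [Finset.sum_const, nsmul_eq_mul, mul_one] at h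
    rw [← h]
    exact_mod_cast SimpleGraph.card_edgeFinset_top_eq_card_choose_two
  rw [h1, h2, h3, Finset.sum_const, nsmul_eq_mul]
  rw [Nat.cast_choose_two] at hcount
  linear_combination ((star φ ⬝ᵥ φ).re / 2) * hcount

omit [DecidableEq V] in
/-- **The Casimir ceiling**: `Re⟨ψ, 𝐒² ψ⟩ ≤ (|V|/2)(|V|/2 + 1)·‖ψ‖²` for every vector (`k` spins ½
have total spin at most `k/2`; `posSemidef_casimirBound_sub`). Tasaki (2020) App. A.3. [folklore] -/
theorem re_totalSpinSq_le_casimirMax [DecidableEq V] (ψ : (V → Fin 2) → ℂ) :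
    (star ψ ⬝ᵥ ((totalSpinSq 1 : Op V 2) *ᵥ ψ)).re ≤
      (Fintype.card V : ℝ) / 2 * ((Fintype.card V : ℝ) / 2 + 1) * (star ψ ⬝ᵥ ψ).re := by
  have hP := posSemidef_casimirBound_sub (Λ := V) (Finset.univ : Finset V)
  have hS : (∑ α : Fin 3, (∑ x ∈ (Finset.univ : Finset V), siteSpin 1 x α) *
      (∑ x ∈ (Finset.univ : Finset V), siteSpin 1 x α) : Op V 2) = totalSpinSq 1 := rfl
  rw [hS, Finset.card_univ] at hP
  have h := (Complex.le_def.1 (hP.dotProduct_mulVec_nonneg ψ)).1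
  rw [sub_mulVec, smul_mulVec, one_mulVec, dotProduct_sub, dotProduct_smul, Complex.sub_re,
    Complex.zero_re, smul_eq_mul] at h
  have hc : (((Fintype.card V : ℂ) * ((Fintype.card V : ℂ) + 2) / 4) * (star ψ ⬝ᵥ ψ)).re =
      (Fintype.card V : ℝ) / 2 * ((Fintype.card V : ℝ) / 2 + 1) * (star ψ ⬝ᵥ ψ).re := by
    rw [show ((Fintype.card V : ℂ) * ((Fintype.card V : ℂ) + 2) / 4) =
        (((Fintype.card V : ℝ) / 2 * ((Fintype.card V : ℝ) / 2 + 1) : ℝ) : ℂ) by push_cast; ring,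
      Complex.re_ofReal_mul]
  rw [hc] at h
  linarith

/-! ### The ferromagnetic ceiling -/

/-- **THE FERROMAGNETIC CEILING** (every connected graph, every sector): for every normalised vector
`ψ₁` of the sector `S^z_tot = M` — a ground state of some `H(Δ₁)` or not — and every normalised
sector ground state `ψ₂` of the isotropic ferromagnet `H(1)`: `Λ(ψ₁) ≤ Λ(ψ₂)` (`ψ₂ ∝ φ_W` has maximal
total spin, and `Re⟨ψ,𝐒²ψ⟩ = Λ(ψ) + (M² − M)‖ψ‖²` within the sector).  Tasaki (2020) §2.5;
Lieb–Mattis (1962). [folklore] -/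
theorem condensate_le_ferroCeiling (G : SimpleGraph V) [DecidableRel G.Adj] (hG : G.Connected)
    {M : ℝ} {ψ₁ ψ₂ : (V → Fin 2) → ℂ}
    (g₁m : ψ₁ ∈ spinZSector (Λ := V) 1 M) (g₁n : star ψ₁ ⬝ᵥ ψ₁ = 1)
    (g₂m : ψ₂ ∈ spinZSector (Λ := V) 1 M) (g₂n : star ψ₂ ⬝ᵥ ψ₂ = 1)
    (g₂e : xxzHamiltonian 1 G (-1) 1 *ᵥ ψ₂ =
      ((lowestEnergyInSector 1 (xxzHamiltonian 1 G (-1) 1) M : ℝ) : ℂ) • ψ₂) :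
    (star ψ₁ ⬝ᵥ (((∑ x, onSite x (spinRaise 1)) * (∑ y, onSite y (spinLower 1)) : Op V 2) *ᵥ ψ₁)).re ≤
      (star ψ₂ ⬝ᵥ (((∑ x, onSite x (spinRaise 1)) * (∑ y, onSite y (spinLower 1)) : Op V 2) *ᵥ ψ₂)).re := by
  -- the sector is the weight-`W` sector of a nonzero vector
  have hψ₂0 : ψ₂ ≠ 0 := by
    intro h; rw [h, dotProduct_zero] at g₂n; exact zero_ne_one g₂n
  obtain ⟨W, ⟨σ₀, hσ₀⟩, hMW⟩ := exists_weight_of_mem_spinZSector g₂m hψ₂0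
  subst hMW
  -- the flat vector of the sector
  obtain ⟨φ, hφ⟩ : ∃ φ : (V → Fin 2) → ℂ, ∀ σ, φ σ = if (∑ z, (σ z : ℕ)) = W then 1 else 0 :=
    ⟨fun σ => if (∑ z, (σ z : ℕ)) = W then 1 else 0, fun σ => rfl⟩
  have hφ0 : φ ≠ 0 := by
    intro h
    have h1 : φ σ₀ = 1 := by rw [hφ σ₀, if_pos hσ₀]
    rw [h] at h1
    exact zero_ne_one h1
  -- `ψ₂ = c φ`, `|c|² ‖φ‖² = 1`
  obtain ⟨c, hc⟩ := sectorGS_at_one_eq_smul_flatW G hG hφ hφ0 g₂m g₂e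
  have hφreal : star φ ⬝ᵥ φ = (((star φ ⬝ᵥ φ).re : ℝ) : ℂ) := by
    rw [dotProduct, Complex.re_sum]
    push_cast
    refine Finset.sum_congr rfl fun σ _ => ?_
    rw [Pi.star_apply, hφ σ]
    split_ifs <;> simp
  have hnorm : ‖c‖ ^ 2 * (star φ ⬝ᵥ φ).re = 1 := by
    have h := g₂n
    rw [hc, star_smul, smul_dotProduct, dotProduct_smul, smul_eq_mul, smul_eq_mul, Complex.star_def,
      ← mul_assoc, Complex.conj_mul', hφreal, ← Complex.ofReal_pow, ← Complex.ofReal_mul] at h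
    exact_mod_cast h
  -- Casimir of both
  have hS1 := re_totalSpinSq_le_casimirMax ψ₁
  rw [g₁n, Complex.one_re, mul_one] at hS1
  have hS2 : (star ψ₂ ⬝ᵥ ((totalSpinSq 1 : Op V 2) *ᵥ ψ₂)).re =
      (Fintype.card V : ℝ) / 2 * ((Fintype.card V : ℝ) / 2 + 1) := by
    rw [hc, mulVec_smul, star_smul, smul_dotProduct, dotProduct_smul, smul_eq_mul, smul_eq_mul,
      ← mul_assoc, Complex.star_def, Complex.conj_mul', ← Complex.ofReal_pow, Complex.re_ofReal_mul,
      re_totalSpinSq_flatW hφ, ← mul_assoc, mul_comm (‖c‖ ^ 2), mul_assoc, hnorm, mul_one]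
  -- translate to the condensate
  rw [OneMagnon.re_totalSpinSq_eq_condensate_add g₁m, g₁n, Complex.one_re, mul_one] at hS1
  rw [OneMagnon.re_totalSpinSq_eq_condensate_add g₂m, g₂n, Complex.one_re, mul_one] at hS2
  linarith

/-- **The `Δ₂ = 1` end point of `U_vt` holds on every connected graph** (no vertex-transitivity):
statement shape of `VertexTransitiveCondensateMonotone` with `Δ₂ = 1`. [folklore] -/
theorem condensateMonotone_at_one :
    ∀ (V : Type) [Fintype V] [DecidableEq V] (G : SimpleGraph V) [DecidableRel G.Adj],
      G.Connected → ∀ (M Δ₁ : ℝ), Δ₁ ≤ 1 →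
      ∀ ψ₁ ψ₂ : TensorIndex V 2 → ℂ,
        ψ₁ ∈ spinZSector (Λ := V) 1 M → star ψ₁ ⬝ᵥ ψ₁ = 1 →
        xxzHamiltonian 1 G (-1) Δ₁ *ᵥ ψ₁ =
          ((lowestEnergyInSector 1 (xxzHamiltonian 1 G (-1) Δ₁) M : ℝ) : ℂ) • ψ₁ →
        ψ₂ ∈ spinZSector (Λ := V) 1 M → star ψ₂ ⬝ᵥ ψ₂ = 1 →
        xxzHamiltonian 1 G (-1) 1 *ᵥ ψ₂ =
          ((lowestEnergyInSector 1 (xxzHamiltonian 1 G (-1) 1) M : ℝ) : ℂ) • ψ₂ →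
        (star ψ₁ ⬝ᵥ (((∑ x, onSite x (spinRaise 1)) * (∑ y, onSite y (spinLower 1)) : Op V 2) *ᵥ ψ₁)).re
          ≤ (star ψ₂ ⬝ᵥ (((∑ x, onSite x (spinRaise 1)) * (∑ y, onSite y (spinLower 1)) : Op V 2) *ᵥ ψ₂)).re :=
  fun _ _ _ G _ hG _ _ _ _ _ g₁m g₁n _ g₂m g₂n g₂e =>
    condensate_le_ferroCeiling G hG g₁m g₁n g₂m g₂n g₂e

end Summit.HubbardSuperconductivity.HubbardSuperconductivity.Theorems.AnisotropyChord
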